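import Summits.Ventures.PercRepro.C025ProfileRankFourCapA
import Summits.Ventures.PercRepro.C025ProfileRankFourCapC
import Summits.Ventures.PercRepro.C025ProfileRankFourCapD
import Summits.Ventures.PercRepro.C025ProfileRankFourDemC
import Summits.Ventures.PercRepro.C025ProfileRankFourDemD

/-!
# THE FIRST OPEN ROW OF THE PROFILE INEQUALITY AT RANK ≤ 4: `(Π_{2,3})` for every matroid of rank ≤ 4 (night-3 g8)

NIGHT3-G7-RANK4-CERTIFICATE.md, assembled: the explicit local certificate `w4n` satisfies
  (Cap)  `Σ_{B ⊆ S, ρ(B) = 2} w4n M B S ≤ 3`  for every rank-`3` set `S`          — `cap_w4n_all`: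
         `|S| = 3` (Cap)(a) `cap_w4n_of_card_three`; `|S| = 4` without a collinear triple (Cap)(b)
         `cap_w4n_card_four_of_no_triple`, with one (Cap)(c) `cap_w4n_of_card_four_of_triple`; `|S| ≥ 5` (Cap)(d)
         `cap_w4n_of_five_le_card`;
  (Dem)  `Σ_{S ⊇ B, ρ(S) = 3} w4n M B S ≥ ρ(E∖B)`  for every rank-`2` set `B` with `ρ(E∖B) ≥ 3` — `dem_w4n_all`:
         `|B| ≥ 3` (Dem)(a), `|B| = 2` with `j(B) = 0, 1, 2` (Dem)(b), (c), (d);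
on every simple matroid of rank `4`, hence by the double count and the rank-restricted reduction to simple matroids
(`profileIneq_two_three_rank_le_four_of_certN`) **`profileIneq_two_three_rank_le_four`**: `(Π_{2,3})` holds for every
finite matroid of rank `≤ 4`, i.e. `3·#{S : ρ(S) = 3} ≥ Σ_{B : ρ(B) = 2, ρ(E∖B) ≥ 3} ρ(E∖B)`
(`three_mul_card_levelSet_three_ge`) — the level-wise form (R1) of `C025` at `(4, 2)` PLUS the term `3·n_{2,3}`.
-/

open scoped Matroid

namespace PercRepro

open Set Finset ThmH

section RankFour

variable {α : Type} [DecidableEq α] {M : Matroid α} [M.Finite]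

/-- **(Cap) for every rank-`3` set** of a simple matroid of rank `4`. -/
theorem cap_w4n_all (hR : M.eRank = (4 : ℕ∞)) (hsimple : ∀ T ⊆ M.E, T.encard ≤ 2 → M.Indep T) {S : Finset α}
    (hS : S ∈ Shadow.levelSet M 3) : ∑ B ∈ (Profile.Rq M 2).filter (fun B => B ⊆ S), w4n M B S ≤ 3 := by
  classical
  have hSg : S ⊆ gr M := (Profile.mem_levelSet.1 hS).1
  have hS3 : M.eRk (S : Set α) = 3 := (Profile.mem_levelSet.1 hS).2
  have hS3c : 3 ≤ S.card := by
    have h := M.eRk_le_encard (S : Set α)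
    rw [hS3, Set.encard_coe_eq_coe_finsetCard] at h
    exact_mod_cast h
  rcases Nat.lt_or_ge S.card 4 with h3 | h4
  · exact cap_w4n_of_card_three hR hsimple hS (by omega)
  rcases Nat.lt_or_ge S.card 5 with h4' | h5
  · have hS4 : S.card = 4 := by omega
    by_cases htri : ∀ T ⊆ S, T.card = 3 → M.eRk (T : Set α) = 3
    · exact cap_w4n_card_four_of_no_triple hS4 htri
    · push Not at htri
      obtain ⟨T, hTS, hTc, hT3⟩ := htri
      -- a triple of S that does not span a plane is collinear
      have hT2 : M.eRk (T : Set α) = 2 := by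
        have hle : M.eRk (T : Set α) ≤ 3 := by rw [← hS3]; exact M.eRk_mono (Finset.coe_subset.2 hTS)
        obtain ⟨U, hUT, hUc⟩ := Finset.exists_subset_card_eq (show 2 ≤ T.card by omega)
        obtain ⟨a, b, hab, hU⟩ := Finset.card_eq_two.1 hUc
        have hge : (2 : ℕ∞) ≤ M.eRk (T : Set α) :=
          two_le_eRk_of_pair_subset hsimple (hTS.trans hSg) (hUT (by rw [hU]; exact Finset.mem_insert_self _ _))
            (hUT (by rw [hU]; exact Finset.mem_insert_of_mem (Finset.mem_singleton_self _))) hab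
        have hfin : M.eRk (T : Set α) ≠ ⊤ := by
          rw [← lt_top_iff_ne_top]; exact (M.isRkFinite_set _).eRk_lt_top
        obtain ⟨n, hn⟩ := ENat.ne_top_iff_exists.1 hfin
        rw [← hn] at hle hge hT3 ⊢
        have h1 : n ≤ 3 := by exact_mod_cast hle
        have h2 : 2 ≤ n := by exact_mod_cast hge
        have h3 : n ≠ 3 := fun h => hT3 (by rw [h]; rfl)
        have : n = 2 := by omega
        rw [this]; rfl
      exact cap_w4n_of_card_four_of_triple hR hsimple hS hS4 hTS hTc hT2
  · exact cap_w4n_of_five_le_card hR hsimple hS h5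

/-- **(Dem) for every rank-`2` set** with `ρ(E∖B) ≥ 3` of a simple matroid of rank `4`. -/
theorem dem_w4n_all (hR : M.eRank = (4 : ℕ∞)) (hsimple : ∀ T ⊆ M.E, T.encard ≤ 2 → M.Indep T) {B : Finset α}
    (hB : B ∈ Profile.Rq M 2) (hp : 3 ≤ crk M B) :
    (crk M B : ℚ) ≤ ∑ S ∈ (Shadow.levelSet M 3).filter (fun S => B ⊆ S), w4n M B S := by
  have h2 := two_le_card_of_mem_Rq_two hB
  rcases Nat.lt_or_ge B.card 3 with hlt | hge
  · have hBc : B.card = 2 := by omega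
    have hj2 : jB M B ≤ 2 := by unfold jB; exact min_le_left _ _
    rcases Nat.lt_or_ge (jB M B) 1 with hj0 | hj1
    · exact dem_w4n_of_jB_eq_zero hsimple hB (by omega) hp
    rcases Nat.lt_or_ge (jB M B) 2 with hj1' | hj2'
    · exact dem_w4n_of_jB_eq_one hB hBc (by omega) hp
    · exact dem_w4n_of_jB_eq_two hR hsimple hB hBc (by omega)
  · exact dem_w4n_of_three_le_card hsimple hB hge hp

/-- **`(Π_{2,3})` FOR EVERY FINITE MATROID OF RANK `≤ 4`** (NIGHT3-G7-RANK4-CERTIFICATE.md): the first open row of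
the profile inequality `C025Profile`, at rank `≤ 4`, by the explicit local certificate `w4n`. -/
theorem profileIneq_two_three_rank_le_four (M : Matroid α) [M.Finite] (hM : M.eRank ≤ (4 : ℕ∞)) :
    Profile.ProfileIneq M 2 3 :=
  profileIneq_two_three_rank_le_four_of_certN
    (fun _N _ hR hsimple => ⟨fun _S hS => cap_w4n_all hR hsimple hS, fun _B hB hp => dem_w4n_all hR hsimple hB hp⟩)
    M hM

/-- The same in plain words: for every finite matroid of rank `≤ 4`,
`Σ_{B : ρ(B) = 2, ρ(E∖B) ≥ 3} ρ(E∖B) ≤ 3 · #{S : ρ(S) = 3}`. -/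
theorem three_mul_card_levelSet_three_ge (M : Matroid α) [M.Finite] (hM : M.eRank ≤ (4 : ℕ∞)) :
    ∑ B ∈ Profile.Rq M 2, (if 3 ≤ crk M B then (crk M B : ℚ) else 0) ≤ 3 * ((Shadow.levelSet M 3).card : ℚ) := by
  have h := profileIneq_two_three_rank_le_four M hM
  unfold Profile.ProfileIneq at h
  have hsum : ∑ B ∈ Profile.Rq M 2, Profile.price M 2 3 B =
      (1 / 3 : ℚ) * ∑ B ∈ Profile.Rq M 2, (if 3 ≤ crk M B then (crk M B : ℚ) else 0) := by
    rw [Finset.mul_sum]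
    apply Finset.sum_congr rfl
    intro B _
    rw [price_two_three_eq]
    split_ifs <;> ring
  rw [hsum] at h
  linarith

end RankFour

end PercRepro
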